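import Summits.CriticalPhenomena.PercolationContinuityZ3.Theorems.Transplant.Slab111VSearch
import HarnessLib

/-!
# The routing certificate for `ShapedLinkage 3 (Slab111.hexShadow k)`, II″: the SEARCHES (executable; evaluated, never trusted)

builds on p205010 (kernel theorem, internal audit signed; external expert review pending) — NOT used in this file.  Lane `prim-bschramm`, seat
`prim-bschramm-p2` (gen 35; class C1b; memo `HOME/bschramm/P2-LATTICES.md` §129); helper file (`--supports stmt-CriticalPhenomena-4575 --as helper`).
Continues «Slab111VSearch» (bitmask geometry, contexts, attachments, options): the core search in two stages — `coresAB` (diamond + rigid cores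
`A, B`, independent of `w'`, lazily enumerated so that the kernel shares it between the `w'`-columns) and `completeT` (the two branch cores, pruned by
flood fills) — the bounded tiered `pairSearch` over option pairs (diagonal order, `w'`-constrained cores for cramped configurations), and the three
searches `searchFree`, `searchAnchored`, `searchStack` that propose plans of the four kinds; every proposed plan is re-checked (`PlanD.checkT`).
-/

namespace Summit.CriticalPhenomena.PercolationContinuityZ3.Theorems.Transplant

namespace Slab111

namespace Srch

/-! ## The searches -/

/-- Pieces of a plan found by the core search. [folklore] -/
structure Pieces where
  /-- options used -/
  o1 : Opt
  /-- see `o1` -/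
  o2 : Opt
  /-- see `o1` -/
  o3a : Opt
  /-- see `o1` -/
  o3b : Opt
  /-- diamond and cores -/
  cA : MV
  /-- see `cA` -/
  cB : MV
  /-- see `cA` -/
  y : MV
  /-- see `cA` -/
  b : MV
  /-- see `cA` -/
  A : List MV
  /-- see `cA` -/
  B : List MV
  /-- see `cA` -/
  T1 : List MV
  /-- see `cA` -/
  T2 : List MV

/-- Assemble a plan. [folklore] -/
def Pieces.toPlan (kind : Kind) (r : Pieces) : PlanD :=
  ⟨kind, r.o1.t, r.o2.t, r.o3a.t, r.o3b.t, r.cA, r.cB, r.y, r.b, r.A, r.B, r.T1, r.T2⟩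

/-- First success over a list (stops at the first success: the tail is never forced). [folklore] -/
def firstSome {α β : Type} : List α → (α → Option β) → Option β
  | [], _ => none
  | a :: l, f => match f a with
    | some r => some r
    | none => firstSome l f

/-- A core of a plan: the diamond with its orientation and the rigid cores `A`, `B` (with their masks). [folklore] -/
structure CoreAB where
  /-- diamond apex where `A` ends -/
  cA : MV
  /-- diamond apex where `B` starts -/
  cB : MV
  /-- middle vertex on the first rerouting -/
  y : MV
  /-- middle vertex heading the first branch -/
  b : MV
  /-- core `p₁ … cA` -/
  A : List MV
  /-- core `cB … p₂` -/
  B : List MV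
  /-- mask of `A` -/
  mA : ℕ
  /-- mask of `B` -/
  mB : ℕ

/-- The cores through one diamond: both orientations, both middle-vertex assignments, both tie-breaks of `A` and of `B`. [folklore] -/
def coresOfDia (S : SCtx) (o1 o2 : Opt) (lo hi : ℤ) (forb : ℕ) (maxlen : ℕ) (vs : List (Bool × Bool)) (dia : MV × MV × MV × MV) :
    List CoreAB :=
  let band := bandMask lo hi
  let vR := S.vR &&& band
  let r12 := o1.reg ||| o2.reg
  let (bot, m1, m2, top) := dia
  [(bot, top), (top, bot)].flatMap fun apex =>
    let (cA, cB) := apex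
    if hasBit o2.reg (vid cA) || hasBit o1.reg (vid cB) || (hasBit o1.reg (vid cA) && !hasBit o1.port (vid cA)) ||
       (hasBit o2.reg (vid cB) && !hasBit o2.port (vid cB)) || hasBit forb (vid cA) || hasBit forb (vid cB) then [] else
    [(m1, m2), (m2, m1)].flatMap fun yb =>
      let (y, b) := yb
      if hasBit r12 (vid y) || hasBit r12 (vid b) || hasBit forb (vid y) || hasBit forb (vid b) then [] else
      let freeA := minus vR (o2.reg ||| minus o1.reg o1.port ||| maskOf [y, b, cB] ||| forb)
      vs.filterMap fun v =>
        match bfsPathV v.1 freeA cA o1.port maxlen with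
        | none => none
        | some Arev =>
          let A := Arev.reverse
          let mA := maskOf A
          let freeB := minus vR (o1.reg ||| minus o2.reg o2.port ||| mA ||| maskOf [y, b] ||| forb)
          match bfsPathV v.2 freeB cB o2.port maxlen with
          | none => none
          | some Bl => some ⟨cA, cB, y, b, A, Bl, mA, maskOf Bl⟩

/-- The cores through the diamonds in the given order with the given tie-breaks, at most about `cap` of them. [folklore] -/
def coresRound (S : SCtx) (o1 o2 : Opt) (lo hi : ℤ) (forb : ℕ) (maxlen : ℕ) (vs : List (Bool × Bool)) :
    List (MV × MV × MV × MV) → ℕ → List CoreAB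
  | [], _ => []
  | _, 0 => []
  | d :: ds, cap + 1 =>
    let cs := coresOfDia S o1 o2 lo hi forb maxlen vs d
    cs ++ coresRound S o1 o2 lo hi forb maxlen vs ds (cap + 1 - cs.length)

/-- **Core search, stage 1** (independent of `w'`): default tie-breaks through all diamonds first, then the other tie-breaks (lazily in the
kernel, which shares this list between all `w'`-columns; bounded for the evaluator). [folklore] -/
def coresAB (S : SCtx) (o1 o2 : Opt) (lo hi : ℤ) (forb : ℕ) (maxlen : ℕ) (dias : List (MV × MV × MV × MV)) (cap : ℕ) : List CoreAB :=
  coresRound S o1 o2 lo hi forb maxlen [(false, false)] dias cap ++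
    coresRound S o1 o2 lo hi forb maxlen [(true, false), (false, true), (true, true)] dias cap

/-- **Core search, stage 2**: complete a core by the two branch cores `T1 : b ⇝ p₃`, `T2 : y ⇝ p₃'` to ports of `w'`-options.  The two
branches are independent given the core; a flood fill from `b` / `y` (independent of `w'`, hence shared by the kernel) prunes the options whose
ports are unreachable before any path search. [folklore] -/
def completeT (S : SCtx) (o1 o2 : Opt) (o3s : List Opt) (lo hi : ℤ) (maxlen : ℕ) (co : CoreAB) : Option Pieces :=
  let vW := S.vW &&& bandMask lo hi
  let r12 := o1.reg ||| o2.reg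
  let sp1 := co.mA ||| co.mB ||| bit (vid co.y); let sp2 := co.mA ||| co.mB ||| bit (vid co.b); let spAll := sp1 ||| sp2
  let base1 := minus vW (r12 ||| sp1); let base2 := minus vW (r12 ||| sp2)
  let Rb := flood base1 maxlen (bit (vid co.b)) (bit (vid co.b))
  let Ry := flood base2 maxlen (bit (vid co.y)) (bit (vid co.y))
  let t1 := firstSome o3s fun o3 =>
    if o3.reg &&& spAll != 0 || o3.port &&& Rb == 0 then none else
    let freeT := minus base1 (minus o3.reg o3.port)
    firstSome [false, true] fun vt => (bfsPathV vt freeT co.b o3.port maxlen).map fun T1 => (o3, T1)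
  match t1 with
  | none => none
  | some (o3, T1) =>
    let t2 := firstSome o3s fun o3b =>
      if o3b.reg &&& spAll != 0 || o3b.port &&& Ry == 0 then none else
      let freeT2 := minus base2 (minus o3b.reg o3b.port)
      (bfsPath freeT2 co.y o3b.port maxlen).map fun T2 => (o3b, T2)
    match t2 with
    | none => none
    | some (o3b, T2) => some ⟨o1, o2, o3, o3b, co.cA, co.cB, co.y, co.b, co.A, co.B, T1, T2⟩

/-- **One attempt on an option pair** with bounded depth: `dS` cores of the shared (`w'`-independent) core list, then for the first `nO` options
of `w'` up to `dO` cores that keep that option's region free. [folklore] -/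
def attempt (S : SCtx) (o3s : List Opt) (dias : List (MV × MV × MV × MV)) (lo hi : ℤ) (forb : ℕ) (maxlen dS dO nO : ℕ) (p : Opt × Opt) :
    Option Pieces :=
  let (o1, o2) := p
  if o1.clash o2 then none else
  let o3ok := o3s.filter fun o => !o.clash o1 && !o.clash o2
  if o3ok.isEmpty then none else
  match firstSome ((coresAB S o1 o2 lo hi forb maxlen dias dS).take dS) (completeT S o1 o2 o3ok lo hi maxlen) with
  | some r => some r
  | none => firstSome (o3ok.take nO) fun o3 =>
      firstSome ((coresAB S o1 o2 lo hi (forb ||| o3.reg) maxlen dias dO).take dO) (completeT S o1 o2 o3ok lo hi maxlen)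

/-- All pairs of two lists in diagonal order (`(0,0), (0,1), (1,0), (0,2), (1,1), (2,0), …`), so that the first options of BOTH terminals are
tried early. [folklore] -/
def diagPairs {α β : Type} (l1 : List α) (l2 : List β) : List (α × β) :=
  (List.range (l1.length + l2.length)).flatMap fun s => (List.range (s + 1)).filterMap fun i =>
    match l1[i]?, l2[s - i]? with
    | some a, some b => some (a, b)
    | _, _ => none

/-- **Tiered pair search** (iterative deepening, bounded): over the option pairs (each with its level window and diamond list), shallow attempts
on the first pairs, then deeper ones; the kernel memoises the shallow attempts, so deepening costs only the new work.  `valid` assembles and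
validates the plan. [folklore] -/
def pairSearch (S : SCtx) (pairs : List (((ℤ × ℤ) × List (MV × MV × MV × MV)) × Opt × Opt)) (o3s : List Opt) (forb : ℕ) (maxlen : ℕ)
    (mode : ℕ) (valid : Pieces → Option PlanD) : Option PlanD :=
  let go (n dS dO nO : ℕ) : Option PlanD :=
    firstSome (pairs.take n) fun e => (attempt S o3s e.1.2 e.1.1.1 e.1.1.2 forb maxlen dS dO nO e.2).bind valid
  match mode with
  | 0 => -- the base free plan: must succeed, go deep if needed
    match go 8 3 1 8 with
    | some P => some P
    | none => match go 8 12 3 8 with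
      | some P => some P
      | none => match go 16 32 6 8 with
        | some P => some P
        | none => match go 48 8 2 8 with
          | some P => some P
          | none => go 6 160 12 12
  | 1 => -- a status-specific free plan: quick try only
    go 8 3 1 6
  | _ => -- anchored / stack plans: few option pairs, deeper constrained cores
    match go 4 6 2 8 with
    | some P => some P
    | none => match go 4 40 8 12 with
      | some P => some P
      | none => go 12 100 12 12

/-- The rhombi of the context with bottom level in `[lo, hi]` and all levels `≤ top`, at most `cap` of them (central ones first). [folklore] -/
def SCtx.diasIn (S : SCtx) (lo hi top : ℤ) (cap : ℕ) : List (MV × MV × MV × MV) :=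
  (S.dias.filter fun d => lo ≤ d.1.2 && d.1.2 ≤ hi && d.2.2.2.2 ≤ top).take cap

/-- Maximal length of a searched core path. [folklore] -/
def MAXLEN : ℕ := 7

/-- Level windows tried for free plans, tight first. [folklore] -/
def WINDOWS : List (ℤ × ℤ) := [(-1,3),(0,4),(-2,2),(-2,3),(-1,4),(-3,3),(-2,4),(-3,4),(-2,5),(-4,5),(-5,7),(-6,8)]

/-- Column mask of a column and its six neighbours. [folklore] -/
def nbrMask (c : Col) : ℕ := (c :: ring6.map fun r => (c.1 + r.1, c.2 + r.2)).foldl (fun acc q => acc ||| bit (cidx q)) 0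

/-- Reorder options: those whose footprint avoids the neighbourhood mask `m` first (order preserved within both parts). [folklore] -/
def awayFirst (m : ℕ) (os : List Opt) : List Opt := os.filter (fun o => o.fm &&& m == 0) ++ os.filter (fun o => o.fm &&& m != 0)

/-- **Free plan search** (all terminals ride, envelope `any`), optionally with required statuses `(s1,s2,s3)` (`9` = no requirement; `mode 0`: the base
plan, searched deep; `mode 1`: a quick status-specific try); only plans passing the checker for this residue are returned. [folklore] -/
def searchFree (S : SCtx) (c1 c2 c3 : Col) (req : ℕ × ℕ × ℕ) (mode : ℕ) : Option PlanD :=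
  let filt (roleE : Bool) (s : ℕ) (a : AttD) : Bool := a.okT S.T roleE && (s == 9 || rideStatusOKT S.T a s)
  let own := bit (cidx c1) ||| bit (cidx c2) ||| bit (cidx c3)
  let o1s := awayFirst (minus (nbrMask c3) own) (((attsOf S.okR c1).filter (filt true req.1)).map (fun a => mkRide S a Env.any))
  let o2s := awayFirst (minus (nbrMask c3) own) (((attsOf S.okR c2).filter (filt true req.2.1)).map (fun a => mkRide S a Env.any))
  let o3s := awayFirst (minus (nbrMask c1 ||| nbrMask c2) own) (((attsOf S.okW c3).filter (filt false req.2.2)).map (fun a => mkRide S a Env.any))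
  -- only option pairs that leave some option of `w'` free are worth searching
  let p12 := (diagPairs o1s o2s).filter fun p => !p.1.clash p.2 && o3s.any fun o => !o.clash p.1 && !o.clash p.2
  let dW := WINDOWS.map fun w => (w, S.diasIn w.1 (w.2 - 2) w.2 300)
  let pairs := dW.flatMap fun wd => p12.map fun p => (wd, p)
  pairSearch S pairs o3s 0 MAXLEN mode fun r =>
    let P := r.toPlan Kind.free
    if P.checkT S.T && P.fits c1 c2 c3 && decide (P.kmin ≤ KMAX) && P.allowsT S.T req.1 req.2.1 req.2.2 then some P else none

/-- Level of a boundary status relative to the anchor: bottom statuses are absolute levels, top statuses are `k − (12 − s)`. [folklore] -/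
def exactRel (side : Bool) (ellOrM : ℤ) (s : ℕ) : ℤ := if side then (s : ℤ) - ellOrM else ellOrM - (12 - (s : ℤ))

/-- All sublists (for exact-subset enumeration, small first). [folklore] -/
def subsetsUpTo3 (l : List ℕ) : List (List ℕ) :=
  let all := l.foldr (fun a acc => acc ++ acc.map (fun s => a :: s)) [[]]
  (all.filter (fun s => s.length == 1)) ++ (all.filter (fun s => s.length == 2)) ++ (all.filter (fun s => s.length == 3))

/-- **Anchored plan search** (`side = true`: bottom, `ℓ = ell`; `false`: top, `ℓ = k − ell`) for the status triple `(s1,s2,s3)`: terminals with a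
status on that side may be exact (subsets tried small-first); the others ride with envelope `any` or with the far envelope. [folklore] -/
def searchAnchored (S : SCtx) (c1 c2 c3 : Col) (s1 s2 s3 : ℕ) (side : Bool) (ell : ℤ) : Option PlanD :=
  let C := S.C; let c0 := C.c0; let kr := C.kr
  let cols := [c1, c2, c3]; let sts := [s1, s2, s3]
  let onSide (s : ℕ) : Bool := if side then s ≤ 2 else 10 ≤ s
  let sideIdx := [0,1,2].filter fun i => onSide (sts.getD i 9)
  if sideIdx.isEmpty then none else
  let kind := if side then Kind.bot ell else Kind.top ell
  let lo : ℤ := if side then -ell else max LAMLO (ell - 8)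
  let hi : ℤ := if side then min LAMHI (-ell + 8) else ell
  let dias := if side then S.diasIn (-ell) (-ell + 4) hi 300 else S.diasIn (ell - 6) (ell - 2) ell 300
  let farEnv (a : AttD) : Env := if side then Env.ge (botFloor c0 a.c - ell + min a.ext 0) else Env.le (ell - topOff c0 kr a.c + max a.ext 0)
  let far (s : ℕ) : Bool := if side then 9 ≤ s else s ≤ 9
  let own := bit (cidx c1) ||| bit (cidx c2) ||| bit (cidx c3)
  let others (i : ℕ) : ℕ := minus (if i < 2 then nbrMask c3 else nbrMask c1 ||| nbrMask c2) own
  let rideOpts (i : ℕ) : List Opt :=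
    let c := cols.getD i (0,0); let s := sts.getD i 9; let roleE := decide (i < 2)
    let as := (attsOf (if i < 2 then S.okR else S.okW) c).filter fun a => a.okT S.T roleE && rideStatusOKT S.T a s
    awayFirst (others i) ((as.map fun a => mkRide S a Env.any) ++ (if far s then as.map (fun a => mkRide S a (farEnv a)) else []))
  let ro := [rideOpts 0, rideOpts 1, rideOpts 2]
  let exactV (i : ℕ) : MV := (cols.getD i (0,0), exactRel side ell (sts.getD i 9))
  -- an exact terminal must be a usable vertex of the window (class, block, peel codes); a terminal no ride serves must be exact
  let exactOK (i : ℕ) : Bool :=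
    let v := exactV i
    LAMLO ≤ v.2 && v.2 ≤ LAMHI && vOK v && (if i < 2 then colRWT S.T v.1 else colWT S.T v.1)
  let must (i : ℕ) : Bool := (ro.getD i []).isEmpty
  if [0,1,2].any (fun i => must i && !(sideIdx.contains i && exactOK i)) then none else
  firstSome ((subsetsUpTo3 sideIdx).filter fun X => X.all exactOK && [0,1,2].all fun i => !must i || X.contains i) fun X =>
    let opts (i : ℕ) : List Opt := if X.contains i then [mkExact (exactV i)] else ro.getD i []
    let exVs := X.map exactV
    if !(exVs.all fun v => LAMLO ≤ v.2 && v.2 ≤ LAMHI) then none else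
    let exMask := maskOf exVs
    let blocked (o : Opt) : Bool := o.reg &&& exMask != 0
    let forbW : ℕ := if X.contains 2 then bit (vid (exactV 2)) else 0
    let o3s := (opts 2).filter fun o => !blocked o
    let pairs := ((diagPairs ((opts 0).filter fun o => !blocked o) ((opts 1).filter fun o => !blocked o)).filter fun p =>
      !p.1.clash p.2 && o3s.any fun o => !o.clash p.1 && !o.clash p.2).map fun p => (((lo, hi), dias), p)
    pairSearch S pairs o3s forbW MAXLEN 2 fun r =>
      let P := r.toPlan kind
      if P.checkT S.T && P.fits c1 c2 c3 && decide (P.kmin ≤ KMAX) && P.allowsT S.T s1 s2 s3 then some P else none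

/-- **Stack search** (`E₁, E₂` on the column `c`, both at middle levels; `low = true`: `E₁` lower): `E_low` exact at `(c, λ₀)`, `E_high` rides up
from a port at relative level `≥ λ₀ + 3`, everything within `[λ₀ − 1, λ₀ + 4]`. [folklore] -/
def searchStack (S : SCtx) (c c3 : Col) (low : Bool) (s3 : ℕ) : Option PlanD :=
  let lam0 := lvlC c % 3
  let oLow := mkExact (c, lam0)
  let highs := ((attsOf S.okR c).filter fun a => a.okT S.T true).map fun a => mkRide S a (Env.ge (lam0 + 3 + min a.ext 0))
  let o3s := ((attsOf S.okW c3).filter fun a => a.okT S.T false && rideStatusOKT S.T a s3).map fun a => mkRide S a Env.any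
  let o3ok := o3s.filter fun o => !hasBit o.reg (vid (c, lam0))
  let highs := highs.filter fun oH => !hasBit oH.reg (vid (c, lam0)) && o3ok.any fun o => !o.clash oH
  let dias := S.diasIn (lam0 - 1) (lam0 + 2) (lam0 + 4) 300
  let pairs := highs.map fun oH => (((lam0 - 1, lam0 + 4), dias), (if low then (oLow, oH) else (oH, oLow)))
  pairSearch S pairs o3ok 0 MAXLEN 2 fun r =>
    let P := r.toPlan (Kind.stk lam0 low)
    if P.checkT S.T && P.fits c c c3 && decide (P.kmin ≤ KMAX) && P.allowsT S.T 9 9 s3 then some P else none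

end Srch

end Slab111

end Summit.CriticalPhenomena.PercolationContinuityZ3.Theorems.Transplant
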